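import Mathlib.Topology.Instances.AddCircle.Real
import Mathlib.Topology.Algebra.Group.Quotient
import Mathlib.Analysis.Normed.Group.Basic
import HarnessLib

/-!
# Injectivity modulo the period on a tube around a periodic axis

Topic `Literature/Geometry/Manifold` (folklore differential topology, companion of
`InjOnNhdsOfCompact.lean`): the "injective on a neighbourhood of a compact set" lemma
(Hirsch, *Differential Topology* (1976), Ch. 2 §1, Lemma 1.3 and Ex. 7; Mathlib's
`Set.InjOn.exists_mem_nhdsSet`) for maps which are PERIODIC in one real variable — the form
needed for tubular neighbourhoods of embedded circles parametrised by `ℝ` (Lee, *Introduction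
to Riemannian Manifolds* (2018), Thm. 5.25, "if `P` is compact … `U` contains a uniform tubular
neighborhood", applied on the cylinder `(ℝ/Tℤ) × V`):

* `exists_radius_injOn_mod_period` — let `g : ℝ × V → Y` (`V` a normed group, `Y` Hausdorff)
  be `T`-periodic in the first variable, continuous at the points of the axis `ℝ × {0}`,
  injective MODULO `T` on the axis and locally injective at each of its points.  Then there is
  `r > 0` such that on the tube `ℝ × B(0, r)`, `g (θ, x) = g (θ', x')` forces `x = x'` and
  `θ' - θ ∈ Tℤ`.

Proof: `g` descends to the cylinder `AddCircle T × V`, where the axis `AddCircle T × {0}` is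
compact and `g` is injective on it; `Set.InjOn.exists_mem_nhdsSet` gives injectivity on a
neighbourhood of the axis, which contains a uniform tube (`IsCompact.nhdsSet_prod_eq`).
Everything is proved; no definitions, no named facts.

## References

* M. W. Hirsch, *Differential Topology*, GTM 33 (1976), Ch. 2 §1, Lemma 1.3, Ex. 7. [HirschDT1976]
* J. M. Lee, *Introduction to Riemannian Manifolds*, 2nd ed., GTM 176 (2018), Thm. 5.25 (proof).
  [LeeRiemannianManifolds2018]
-/

noncomputable section

open Set Function Filter Metric Topology

namespace Literature.Geometry.Manifold

variable {V : Type*} [NormedAddCommGroup V] {Y : Type*} [TopologicalSpace Y]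

/-- **Continuity descends along an open surjection.**  If `h = ğ ∘ q` with `q` an open map,
and `h` is continuous at `a`, then `ğ` is continuous at `q a`. [folklore] -/
theorem continuousAt_of_comp_isOpenMap {X X' : Type*} [TopologicalSpace X] [TopologicalSpace X']
    {q : X → X'} (hq : IsOpenMap q) {ğ : X' → Y} {a : X} (h : ContinuousAt (ğ ∘ q) a) :
    ContinuousAt ğ (q a) := by
  intro W hW
  have h1 : (ğ ∘ q) ⁻¹' W ∈ 𝓝 a := h hW
  have h2 : q '' ((ğ ∘ q) ⁻¹' W) ∈ 𝓝 (q a) := hq.image_mem_nhds h1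
  change ğ ⁻¹' W ∈ 𝓝 (q a)
  refine mem_of_superset h2 ?_
  rintro _ ⟨y, hy, rfl⟩
  exact hy

variable [T2Space Y]

/-- **Injectivity modulo the period on a tube around a periodic axis** (Hirsch 1976, Ch. 2 §1
Ex. 7 / Lee 2018 Thm. 5.25, periodic form).  Let `g : ℝ × V → Y` be `T`-periodic in `θ`
(`T > 0`), continuous at every point `(θ, 0)` of the axis, injective modulo `T` on the axis
(`g(θ, 0) = g(θ', 0) → θ' - θ ∈ Tℤ`) and injective on some neighbourhood of each axis point.
Then for some `r > 0`: whenever `‖x‖, ‖x'‖ < r` and `g (θ, x) = g (θ', x')`, we have `x = x'`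
and `θ' = θ + kT` for an integer `k`. [cite: HirschDT1976, Ch. 2 §1 Ex. 7] -/
theorem exists_radius_injOn_mod_period {g : ℝ × V → Y} {T : ℝ} (hT : 0 < T)
    (hper : ∀ θ x, g (θ + T, x) = g (θ, x)) (hcont : ∀ θ : ℝ, ContinuousAt g (θ, 0))
    (hinj : ∀ θ θ' : ℝ, g (θ, 0) = g (θ', 0) → ∃ k : ℤ, θ' = θ + k * T)
    (hloc : ∀ θ : ℝ, ∃ U ∈ 𝓝 ((θ, 0) : ℝ × V), InjOn g U) :
    ∃ r : ℝ, 0 < r ∧ ∀ θ θ' : ℝ, ∀ x x' : V, ‖x‖ < r → ‖x'‖ < r →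
      g (θ, x) = g (θ', x') → x = x' ∧ ∃ k : ℤ, θ' = θ + k * T := by
  haveI : Fact (0 < T) := ⟨hT⟩
  -- (1) descend `g` to the cylinder `AddCircle T × V`
  have hp : ∀ x : V, Function.Periodic (fun θ : ℝ ↦ g (θ, x)) T := fun x θ ↦ hper θ x
  set π : ℝ → AddCircle T := fun θ ↦ (θ : AddCircle T) with hπ
  set gb : AddCircle T × V → Y := fun p ↦ (hp p.2).lift p.1 with hgb
  have hgb_apply : ∀ θ : ℝ, ∀ x : V, gb (π θ, x) = g (θ, x) := fun θ x ↦ (hp x).lift_coe θ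
  set Q : ℝ × V → AddCircle T × V := fun q ↦ (π q.1, q.2) with hQ
  have hQopen : IsOpenMap Q := (QuotientAddGroup.isOpenMap_coe).prodMap IsOpenMap.id
  have hcomp : gb ∘ Q = g := funext fun q ↦ hgb_apply q.1 q.2
  -- (2) hypotheses of `Set.InjOn.exists_mem_nhdsSet` on the compact axis of the cylinder
  set K : Set (AddCircle T × V) := (univ : Set (AddCircle T)) ×ˢ ({0} : Set V) with hK
  have hKc : IsCompact K := isCompact_univ.prod isCompact_singleton
  have hinjK : InjOn gb K := by
    rintro ⟨a, x⟩ ⟨-, hx⟩ ⟨a', x'⟩ ⟨-, hx'⟩ heq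
    simp only [mem_singleton_iff] at hx hx'
    subst hx hx'
    induction a using QuotientAddGroup.induction_on with
    | H θ =>
      induction a' using QuotientAddGroup.induction_on with
      | H θ' =>
        have h1 : g (θ, 0) = g (θ', 0) := by rw [← hgb_apply, ← hgb_apply]; exact heq
        obtain ⟨k, hk⟩ := hinj θ θ' h1
        have : (θ' : AddCircle T) = θ := by
          rw [hk, QuotientAddGroup.eq]
          refine AddSubgroup.mem_zmultiples_iff.2 ⟨-k, ?_⟩
          simp only [zsmul_eq_mul, Int.cast_neg]
          ring
        rw [this]
  have hcontK : ∀ p ∈ K, ContinuousAt gb p := by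
    rintro ⟨a, x⟩ ⟨-, hx⟩
    simp only [mem_singleton_iff] at hx
    subst hx
    induction a using QuotientAddGroup.induction_on with
    | H θ =>
      have h := hcont θ
      rw [← hcomp] at h
      exact continuousAt_of_comp_isOpenMap hQopen h
  have hlocK : ∀ p ∈ K, ∃ u ∈ 𝓝 p, InjOn gb u := by
    rintro ⟨a, x⟩ ⟨-, hx⟩
    simp only [mem_singleton_iff] at hx
    subst hx
    induction a using QuotientAddGroup.induction_on with
    | H θ =>
      obtain ⟨U, hU, hinjU⟩ := hloc θ
      refine ⟨Q '' U, hQopen.image_mem_nhds hU, ?_⟩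
      rintro _ ⟨q, hq, rfl⟩ _ ⟨q', hq', rfl⟩ heq
      have h1 : g q = g q' := by
        rw [← hcomp]
        exact heq
      rw [hinjU hq hq' h1]
  -- (3) injectivity on a neighbourhood of the axis, containing a uniform tube
  obtain ⟨t, ht, hinjt⟩ := hinjK.exists_mem_nhdsSet hKc hcontK hlocK
  rw [hK, isCompact_univ.nhdsSet_prod_eq isCompact_singleton, nhdsSet_singleton,
    nhdsSet_univ] at ht
  obtain ⟨t₁, ht₁, t₂, ht₂, hsub⟩ := Filter.mem_prod_iff.1 ht
  obtain ⟨r, hr, hball⟩ := Metric.mem_nhds_iff.1 ht₂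
  refine ⟨r, hr, fun θ θ' x x' hx hx' heq ↦ ?_⟩
  have hmem : ∀ (a : AddCircle T) (y : V), ‖y‖ < r → (a, y) ∈ t := fun a y hy ↦
    hsub ⟨by rw [Filter.mem_top.1 ht₁]; trivial, hball (by simpa using hy)⟩
  have heq' : gb (π θ, x) = gb (π θ', x') := by rw [hgb_apply, hgb_apply]; exact heq
  have hpt := hinjt (hmem _ _ hx) (hmem _ _ hx') heq'
  have hfst : (θ : AddCircle T) = θ' := congrArg Prod.fst hpt
  refine ⟨congrArg Prod.snd hpt, ?_⟩
  obtain ⟨m, hm⟩ := AddSubgroup.mem_zmultiples_iff.1 (QuotientAddGroup.eq.1 hfst)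
  refine ⟨m, ?_⟩
  have hm' : (m : ℝ) * T = -θ + θ' := by rw [← hm, zsmul_eq_mul]
  linarith

end Literature.Geometry.Manifold

end
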